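/-
Copyright (c) 2026 the pub-hodgecm-mathlib formalisation cell (harness21).  Prover seat hodgecm-mathlib-K2E4-p10 (g6), Track B ∕ K2-LIT, h413 =
`stmt-HodgeConjecture-24833`, line `K2_E1_TraceFormulaBeta`, campaign «EIS-R7-BL-SPH-3», (RES) letter payer (P-cusp), part 2: the CONSTANT TERM of the residue function of the
continued Eisenstein series on `U(J₃)` is the constant `φ₀r` — along EVERY Haar measure and EVERY fundamental domain (dealer K2E1-plan (g6) (89), 2026-09-04).
-/
import Summits.HodgeConjecture.HodgeConjecture.Theorems.K2E1ContinuedEisensteinResidueFunctionUThree   -- THIS SEAT: the residue function (continuity, `G(F)`-invariance, the uniform bound near the pole)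
import Literature.NumberTheory.Automorphic.UnitaryGroupHeisenbergFundamentalDomain                      -- ★ `heisFundamentalDomain` (`𝓕_N`: fundamental for EVERY measure, compact closure, Borel)
import Literature.NumberTheory.Automorphic.UnitaryGroupKernelClassOrbitalUnfolding                      -- ★ `countable_arithmeticSubgroup_quasiSplit`
import Literature.NumberTheory.Automorphic.UnitaryGroupBorelCuspForms                                   -- ★ `borelConstantTerm_smul_measure`
import Mathlib.MeasureTheory.Measure.Haar.Unique
import HarnessLib

/-!
# K2·E1 — `K2E1ContinuedEisensteinResidueConstantTermUThree` ((RES) payer (P-cusp), part 2, `U(J₃)_{E/F}`): THE CONSTANT TERM OF THE RESIDUE FUNCTION `g ↦ Res_{z=2}Ẽ(z)(g)` IS THE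
# CONSTANT `φ₀·r`, ALONG EVERY HAAR MEASURE OF `N(𝔸)` AND EVERY FUNDAMENTAL DOMAIN OF `N(F)`

Track B ∕ K2-LIT, crux h413 = `stmt-HodgeConjecture-24833`, route of record `HCCMUnconditional`; cell `hodgecm-mathlib`, squad K2, ENGINE E1, campaign EIS-R7-BL-SPH-3 (R31).  Prover seat
`hodgecm-mathlib-K2E4-p10` (g6); RE-KEY (89) of the dealer K2E1-plan (g6).  THEOREMS ONLY (no `def`, no `instance`, no notation, no named-fact hypothesis, no `sorry`); lane
`--supports stmt-HodgeConjecture-24833 --as helper` (count-neutral).  Closes no socket.  Generic CM-type extension `E/F`, `c² = 1`.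

THE MATHEMATICS ([MoeglinWaldspurger1995, IV.1.11, II.1.7]; [Langlands1976, §7]).  With `Φ_g(z) = (z−2)Ẽ(z)(g)` bounded near `2` uniformly for `g` in compacts (★ part 1), dominated convergence
on a fundamental domain `𝓕₀` of compact closure gives `∫_{𝓕₀} Res Ẽ(u g) dν(u) = lim_{z→2} (z−2)∫_{𝓕₀} Ẽ(z)(u g) dν(u) = ν(𝓕₀)·lim (z−2)Ẽ(z)_B(g) = ν(𝓕₀)·lim (z−2)φ₀(H(g)^z + c̃(z)H(g)^{2−z})
= ν(𝓕₀)·φ₀r` ((E3′) everywhere; `(z−2)c̃(z) → r`).  The reference identity (E3′) is stated for ONE Haar measure and ONE fundamental domain; §1 transports constant terms across Haar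
measures (uniqueness, Mathlib `Measure.isMulLeftInvariant_eq_smul`; ★ `borelConstantTerm_smul_measure`) and across fundamental domains of `N(F)` for left-`G(F)`-invariant functions
(Mathlib `IsFundamentalDomain.setIntegral_eq ∕ measure_eq`), and the Heisenberg domain `𝓕_N` (★ `heisFundamentalDomain`, fundamental for every measure, compact closure) carries the
computation to an ARBITRARY fundamental domain (the ★ pattern of `K2E1CuspFormsMeanZeroCMThree`):
* §1 `borelConstantTerm_smul_measure_eq`, `borelConstantTerm_eq_of_isFundamentalDomain` (the two transports).
* §2 **`integrableOn_and_setIntegral_residueValue_sub_eq_zero`** — for EVERY Haar `ν'` on `N(𝔸)` and EVERY fundamental domain `𝓕'` of `N(F)`: `u ↦ F (u·x) 2 − φ₀r` is integrable on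
  `𝓕'` with integral `0` — verbatim the integrand of ★ `ConstantTermVanishes` for the function `[g] ↦ F g̃⁻¹ 2 − φ₀r` at the point `x⁻¹` (consumer: ★
  `K2E1SphericalEisensteinResidueCuspidalCMThree`, this seat).
HONEST LABEL: HC_CM is proved only modulo the 7 printed citations (2 remaining named inputs: hLiu418 = `stmt-HodgeConjecture-24832`, h413 = `stmt-HodgeConjecture-24833`) until rung 0
closes; this file asserts no named fact and closes no socket; its head is CONDITIONAL on the EXPORTS₃ letters (E1)(E4)(E2-bd)(E3′) and the pole letters (F), `(z−2)c̃(z) → r`.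
References: [MoeglinWaldspurger1995] I.2.6, II.1.7, IV.1.11 · [Langlands1976] §7 · [Rogawski1990] §2.1 · [BorelJacquet1979] §4.4.
-/

set_option autoImplicit false
-- the mandated namespace repeats the single-problem summit's segment (`HodgeConjecture.HodgeConjecture`)
set_option linter.dupNamespace false

noncomputable section

open MeasureTheory Measure NumberField IsDedekindDomain Set Filter Topology Metric MulAction
open scoped ENNReal NNReal Pointwise
open Literature.NumberTheory
open Literature.NumberTheory.Automorphic Literature.NumberTheory.Automorphic.UnitaryGroup AdelicGroupData
open Summit.HodgeConjecture.HodgeConjecture.Cruxes.H413.K2E1ContinuedEisensteinResidueFunctionUThree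

namespace Summit.HodgeConjecture.HodgeConjecture.Cruxes.H413.K2E1ContinuedEisensteinResidueConstantTermUThree

variable {F E : Type} [Field F] [NumberField F] [Field E] [NumberField E] [Algebra F E] {c : E ≃ₐ[F] E}
variable [MeasurableSpace (quasiSplit F E c 3).Adelic] [BorelSpace (quasiSplit F E c 3).Adelic]

/-! ## §1 Transport of constant terms across Haar measures and across fundamental domains -/

section Transport

omit [BorelSpace (quasiSplit F E c 3).Adelic] in
/-- **SCALING THE HAAR MEASURE DOES NOT CHANGE THE CONSTANT TERM** (`a ≠ 0, ∞`; the normalisation `ν(𝓕)⁻¹` absorbs the factor; ★ `borelConstantTerm_smul_measure`). [cite: Rogawski1990, §2.1] -/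
theorem borelConstantTerm_smul_measure_eq (ν : Measure ↥(adelicUnipotent F E c 3)) (𝓕 : Set ↥(adelicUnipotent F E c 3)) {a : ℝ≥0∞} (ha0 : a ≠ 0) (hatop : a ≠ ∞)
    (φ : (quasiSplit F E c 3).Adelic → ℂ) (g : (quasiSplit F E c 3).Adelic) : borelConstantTerm (a • ν) 𝓕 φ g = borelConstantTerm ν 𝓕 φ g := by
  rw [borelConstantTerm_smul_measure, borelConstantTerm_def, smul_smul, ENNReal.toReal_mul]
  congr 1
  have ha : a.toReal ≠ 0 := ENNReal.toReal_ne_zero.2 ⟨ha0, hatop⟩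
  by_cases hm : (ν 𝓕).toReal = 0
  · rw [hm, mul_zero, inv_zero, zero_mul]
  · field_simp

omit [MeasurableSpace (quasiSplit F E c 3).Adelic] [BorelSpace (quasiSplit F E c 3).Adelic] in
/-- **THE CONSTANT TERM OF A LEFT-`G(F)`-INVARIANT FUNCTION DOES NOT DEPEND ON THE FUNDAMENTAL DOMAIN** (two fundamental domains of `N(F)` have the same measure and carry the same integral of an
`N(F)`-invariant integrand; Mathlib `IsFundamentalDomain.measure_eq ∕ setIntegral_eq`). [cite: MoeglinWaldspurger1995, I.2.6] [cite: BorelJacquet1979, §4.4] -/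
theorem borelConstantTerm_eq_of_isFundamentalDomain [MeasurableSpace ↥(adelicUnipotent F E c 3)] (ν : Measure ↥(adelicUnipotent F E c 3))
    [Countable ↥(rationalUnipotent F E c 3)] [MeasurableConstSMul ↥(rationalUnipotent F E c 3) ↥(adelicUnipotent F E c 3)]
    [SMulInvariantMeasure ↥(rationalUnipotent F E c 3) ↥(adelicUnipotent F E c 3) ν]
    {𝓕₁ 𝓕₂ : Set ↥(adelicUnipotent F E c 3)} (h𝓕₁ : IsFundamentalDomain ↥(rationalUnipotent F E c 3) 𝓕₁ ν) (h𝓕₂ : IsFundamentalDomain ↥(rationalUnipotent F E c 3) 𝓕₂ ν)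
    {u : (quasiSplit F E c 3).Adelic → ℂ} (hu : ∀ (γ : (quasiSplit F E c 3).arithmeticSubgroup) (x : (quasiSplit F E c 3).Adelic), u ((γ : (quasiSplit F E c 3).Adelic) * x) = u x)
    (g : (quasiSplit F E c 3).Adelic) : borelConstantTerm ν 𝓕₁ u g = borelConstantTerm ν 𝓕₂ u g := by
  rw [borelConstantTerm_def, borelConstantTerm_def, h𝓕₁.measure_eq h𝓕₂,
    h𝓕₁.setIntegral_eq h𝓕₂ (f := fun v : ↥(adelicUnipotent F E c 3) => u ((v : (quasiSplit F E c 3).Adelic) * g)) fun γ v => ?_]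
  show u ((((γ : ↥(adelicUnipotent F E c 3)) : (quasiSplit F E c 3).Adelic) * (v : (quasiSplit F E c 3).Adelic)) * g) = u ((v : (quasiSplit F E c 3).Adelic) * g)
  rw [mul_assoc]
  exact hu ⟨_, γ.2⟩ _

end Transport

/-! ## §2 The constant term of the residue function along every Haar measure and every fundamental domain -/

section ConstantTerm

/-- **THE CONSTANT TERM OF `Res Ẽ − φ₀r` VANISHES, ON EVERY FUNDAMENTAL DOMAIN, FOR EVERY HAAR MEASURE** (`U(J₃)`, `c² = 1`).  DATA: a Haar measure `ν'` on `N(𝔸)` and a fundamental domain `𝓕'`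
of `N(F)` (arbitrary); the reference pair `(ν, 𝓕)` (Haar, compact closure) of the continued constant term (E3′) `Ẽ(z)_B = φ₀(H^z + c̃(z)H^{2−z})` on `D`; the continued values `Ẽ` on an
open `D ⊇ B(2,ρ)∖{2}` with (E1)(E4)(E2-bd) and left-`G(F)`-invariance; `(z−2)c̃(z) → r`; the pole letter `F g =ᶠ (z−2)Ẽ(z)(g)`, analytic at `2`.  CONCLUSION: for every `x`,
`u ↦ F(u·x) 2 − φ₀r` is integrable on `𝓕'` with `∫_{𝓕'} (F(u·x) 2 − φ₀r) dν'(u) = 0` — dominated convergence on the Heisenberg domain `𝓕_N` (★), (E3′) transported to `(ν', 𝓕_N)` (§1),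
then `𝓕_N ↝ 𝓕'`. [cite: MoeglinWaldspurger1995, IV.1.11, II.1.7] [cite: Langlands1976, §7] -/
theorem integrableOn_and_setIntegral_residueValue_sub_eq_zero (hc : c * c = 1)
    (ν' : Measure ↥(adelicUnipotent F E c 3)) [ν'.IsHaarMeasure] {𝓕' : Set ↥(adelicUnipotent F E c 3)} (h𝓕' : IsFundamentalDomain ↥(rationalUnipotent F E c 3) 𝓕' ν')
    (ν : Measure ↥(adelicUnipotent F E c 3)) [ν.IsHaarMeasure] {𝓕 : Set ↥(adelicUnipotent F E c 3)} (h𝓕N : IsFundamentalDomain ↥(rationalUnipotent F E c 3) 𝓕 ν)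
    (φ₀ : ℂ) (Ec : ℂ → (quasiSplit F E c 3).Adelic → ℂ) {D : Set ℂ} (hDo : IsOpen D) {ρ : ℝ} (hρ : 0 < ρ) (hρD : ∀ z : ℂ, z ≠ 2 → dist z 2 < ρ → z ∈ D)
    (hEd : ∀ g, DifferentiableOn ℂ (fun z => Ec z g) D) (hE4 : ∀ z ∈ D, Continuous (Ec z))
    (hEbd : ∀ z₀ ∈ D, ∀ K : Set (quasiSplit F E c 3).Adelic, IsCompact K → ∃ V ∈ 𝓝 z₀, ∃ M : ℝ, ∀ z ∈ V, ∀ g ∈ K, ‖Ec z g‖ ≤ M)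
    (hEcinv : ∀ z ∈ D, ∀ (γ : (quasiSplit F E c 3).arithmeticSubgroup) (x : (quasiSplit F E c 3).Adelic), Ec z ((γ : (quasiSplit F E c 3).Adelic) * x) = Ec z x)
    {cc : ℂ → ℂ} {r : ℂ} (hcres : Tendsto (fun z : ℂ => (z - 2) * cc z) (𝓝[≠] 2) (𝓝 r))
    (hE3 : ∀ z ∈ D, ∀ g : (quasiSplit F E c 3).Adelic,
      borelConstantTerm ν 𝓕 (Ec z) g = φ₀ * ((((borelHeight g : ℝ≥0) : ℝ) : ℂ) ^ z + cc z * (((borelHeight g : ℝ≥0) : ℝ) : ℂ) ^ (2 - z)))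
    (Fp : (quasiSplit F E c 3).Adelic → ℂ → ℂ) (hF : ∀ g, AnalyticAt ℂ (Fp g) 2) (hFE : ∀ g, Fp g =ᶠ[𝓝[≠] 2] fun z => (z - 2) * Ec z g)
    (x : (quasiSplit F E c 3).Adelic) :
    IntegrableOn (fun u : ↥(adelicUnipotent F E c 3) => Fp ((u : (quasiSplit F E c 3).Adelic) * x) 2 - φ₀ * r) 𝓕' ν' ∧
      ∫ u in 𝓕', (Fp ((u : (quasiSplit F E c 3).Adelic) * x) 2 - φ₀ * r) ∂ν' = 0 := by
  -- structure on `G(𝔸)`, `N(𝔸)`, `N(F)` (the ★ boilerplate of `K2E1CuspFormsMeanZeroCMThree`)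
  haveI := t2Space_adeleRing_of_numberField E
  haveI := locallyCompactSpace_adeleRing' E
  haveI := secondCountableTopology_adeleRing E
  letI : MeasurableSpace (AdeleRing (𝓞 E) E) := borel _
  haveI : BorelSpace (AdeleRing (𝓞 E) E) := ⟨rfl⟩
  haveI : T2Space (quasiSplit F E c 3).Adelic := inferInstanceAs (T2Space (adelic F E c 3 ((StdForm.antidiagonal 3).over E)))
  haveI : SecondCountableTopology (quasiSplit F E c 3).Adelic := inferInstanceAs (SecondCountableTopology (adelic F E c 3 ((StdForm.antidiagonal 3).over E)))
  haveI : LocallyCompactSpace (quasiSplit F E c 3).Adelic := inferInstanceAs (LocallyCompactSpace (adelic F E c 3 ((StdForm.antidiagonal 3).over E)))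
  haveI : LocallyCompactSpace ↥(adelicUnipotent F E c 3) := by
    have hcl : IsClosed ((adelicUnipotent F E c 3 : Set (quasiSplit F E c 3).Adelic)) := by
      change IsClosed (⇑(adelicVal F E c 3 ((StdForm.antidiagonal 3).over E)) ⁻¹'
        ((upperUnitriangular (Fin 3) (AdeleRing (𝓞 E) E) : Subgroup (GL (Fin 3) (AdeleRing (𝓞 E) E))) : Set (GL (Fin 3) (AdeleRing (𝓞 E) E))))
      exact (isClosed_upperUnitriangular (R := AdeleRing (𝓞 E) E)).preimage continuous_subtype_val
    exact hcl.locallyCompactSpace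
  haveI : SecondCountableTopology ↥(adelicUnipotent F E c 3) := TopologicalSpace.Subtype.secondCountableTopology _
  haveI : MeasurableConstSMul ↥(rationalUnipotent F E c 3) ↥(adelicUnipotent F E c 3) := ⟨fun γ => (continuous_const.mul continuous_id).measurable⟩
  haveI : SMulInvariantMeasure ↥(rationalUnipotent F E c 3) ↥(adelicUnipotent F E c 3) ν' :=
    ⟨fun γ s _hs => by
      rw [show (fun u : ↥(adelicUnipotent F E c 3) => γ • u) ⁻¹' s = (fun u : ↥(adelicUnipotent F E c 3) => (γ : ↥(adelicUnipotent F E c 3)) * u) ⁻¹' s from rfl, measure_preimage_mul]⟩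
  haveI : SMulInvariantMeasure ↥(rationalUnipotent F E c 3) ↥(adelicUnipotent F E c 3) ν :=
    ⟨fun γ s _hs => by
      rw [show (fun u : ↥(adelicUnipotent F E c 3) => γ • u) ⁻¹' s = (fun u : ↥(adelicUnipotent F E c 3) => (γ : ↥(adelicUnipotent F E c 3)) * u) ⁻¹' s from rfl, measure_preimage_mul]⟩
  haveI : Countable ↥(rationalUnipotent F E c 3) := by
    haveI : Countable (quasiSplit F E c 3).arithmeticSubgroup := countable_arithmeticSubgroup_quasiSplit
    have hinj : Function.Injective (fun γ : ↥(rationalUnipotent F E c 3) => (⟨((γ : ↥(adelicUnipotent F E c 3)) : (quasiSplit F E c 3).Adelic), γ.2⟩ : (quasiSplit F E c 3).arithmeticSubgroup)) := by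
      intro a b h
      exact Subtype.ext (Subtype.ext (congrArg (fun z : (quasiSplit F E c 3).arithmeticSubgroup => (z : (quasiSplit F E c 3).Adelic)) h))
    exact hinj.countable
  -- the Heisenberg fundamental domain `𝓕₀` (compact closure, fundamental for every measure)
  obtain ⟨𝓕₀, h𝓕₀def⟩ : ∃ 𝓕₀ : Set ↥(adelicUnipotent F E c 3), 𝓕₀ = heisFundamentalDomain F E c hc := ⟨_, rfl⟩
  have h𝓕₀' : IsFundamentalDomain ↥(rationalUnipotent F E c 3) 𝓕₀ ν' := by rw [h𝓕₀def]; exact isFundamentalDomain_heisFundamentalDomain hc ν'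
  have h𝓕₀ν : IsFundamentalDomain ↥(rationalUnipotent F E c 3) 𝓕₀ ν := by rw [h𝓕₀def]; exact isFundamentalDomain_heisFundamentalDomain hc ν
  obtain ⟨K₀, hK₀c, hK₀⟩ := exists_isCompact_heisFundamentalDomain_subset (F := F) (E := E) (c := c) hc
  rw [← h𝓕₀def] at hK₀
  have h𝓕₀m : MeasurableSet 𝓕₀ := by rw [h𝓕₀def]; exact measurableSet_heisFundamentalDomain hc
  have h𝓕₀top : ν' 𝓕₀ < ∞ := (measure_mono hK₀).trans_lt hK₀c.measure_lt_top
  have h𝓕₀0 : ν' 𝓕₀ ≠ 0 := measure_ne_zero_of_isFundamentalDomain_rationalUnipotent ν' h𝓕₀'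
  have hreal0 : (ν' 𝓕₀).toReal ≠ 0 := ENNReal.toReal_ne_zero.2 ⟨h𝓕₀0, h𝓕₀top.ne⟩
  haveI : IsFiniteMeasure (ν'.restrict 𝓕₀) := isFiniteMeasure_restrict.2 h𝓕₀top.ne
  have hD2 : ∀ᶠ z in 𝓝[≠] (2 : ℂ), z ∈ D := by
    filter_upwards [inter_mem_nhdsWithin _ (ball_mem_nhds (2 : ℂ) hρ)] with z hz
    exact hρD z hz.1 (mem_ball.1 hz.2)
  -- the integrand and its `N(F)`-invariance
  have hRc : Continuous fun g : (quasiSplit F E c 3).Adelic => Fp g 2 := continuous_residueValue Ec hDo hρ hρD hEd hE4 hEbd Fp hF hFE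
  have hIc : Continuous fun u : ↥(adelicUnipotent F E c 3) => Fp ((u : (quasiSplit F E c 3).Adelic) * x) 2 - φ₀ * r :=
    (hRc.comp (continuous_subtype_val.mul continuous_const)).sub continuous_const
  have hIinv : ∀ (γ : ↥(rationalUnipotent F E c 3)) (u : ↥(adelicUnipotent F E c 3)),
      Fp ((((γ • u : ↥(adelicUnipotent F E c 3))) : (quasiSplit F E c 3).Adelic) * x) 2 - φ₀ * r = Fp ((u : (quasiSplit F E c 3).Adelic) * x) 2 - φ₀ * r := fun γ u => by
    show Fp ((((γ : ↥(adelicUnipotent F E c 3)) : (quasiSplit F E c 3).Adelic) * (u : (quasiSplit F E c 3).Adelic)) * x) 2 - φ₀ * r = _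
    rw [mul_assoc]
    congr 1
    exact residueValue_rational_mul Ec hD2 hEcinv Fp hF hFE ⟨_, γ.2⟩ _
  -- (i) integrability on `𝓕₀` (continuous integrand, `𝓕₀ ⊆ K₀` compact, `ν' 𝓕₀ < ∞`)
  obtain ⟨M₀, hM₀⟩ := hK₀c.exists_bound_of_continuousOn hIc.continuousOn
  have hint₀ : IntegrableOn (fun u : ↥(adelicUnipotent F E c 3) => Fp ((u : (quasiSplit F E c 3).Adelic) * x) 2 - φ₀ * r) 𝓕₀ ν' :=
    Measure.integrableOn_of_bounded h𝓕₀top.ne hIc.aestronglyMeasurable (M := M₀) (by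
      filter_upwards [ae_restrict_mem h𝓕₀m] with u hu using hM₀ u (hK₀ hu))
  -- (ii) dominated convergence on `𝓕₀`: `∫_{𝓕₀} F(u x) 2 dν' = lim (z−2) ∫_{𝓕₀} Ẽ(z)(u x) dν'`
  have hKx : IsCompact ((fun u : ↥(adelicUnipotent F E c 3) => (u : (quasiSplit F E c 3).Adelic) * x) '' K₀) := hK₀c.image (continuous_subtype_val.mul continuous_const)
  obtain ⟨M₁, -, hM₁, hM₁F⟩ := exists_forall_norm_sub_mul_le_near_two Ec hDo hρ hρD hEd hEbd Fp hF hFE hKx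
  have hlim₁ : Tendsto (fun z : ℂ => ∫ u in 𝓕₀, (z - 2) * Ec z ((u : (quasiSplit F E c 3).Adelic) * x) ∂ν') (𝓝[≠] 2)
      (𝓝 (∫ u in 𝓕₀, Fp ((u : (quasiSplit F E c 3).Adelic) * x) 2 ∂ν')) := by
    refine tendsto_integral_filter_of_dominated_convergence (fun _ => M₁) ?_ ?_ (integrable_const M₁) (ae_of_all _ fun u => ?_)
    · filter_upwards [hD2] with z hz
      exact (continuous_const.mul ((hE4 z hz).comp (continuous_subtype_val.mul continuous_const))).aestronglyMeasurable
    · have hmem : {z : ℂ | z ≠ 2} ∩ ball (2 : ℂ) (ρ / 2) ∈ 𝓝[≠] (2 : ℂ) := inter_mem_nhdsWithin _ (ball_mem_nhds _ (half_pos hρ))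
      filter_upwards [hmem] with z hz
      filter_upwards [ae_restrict_mem h𝓕₀m] with u hu
      exact hM₁ _ ⟨u, hK₀ hu, rfl⟩ z hz.1 (mem_ball.1 hz.2).le
    · have h1 : Tendsto (Fp ((u : (quasiSplit F E c 3).Adelic) * x)) (𝓝[≠] 2) (𝓝 (Fp ((u : (quasiSplit F E c 3).Adelic) * x) 2)) :=
        tendsto_nhdsWithin_of_tendsto_nhds (hF _).continuousAt.tendsto
      exact h1.congr' (hFE _)
  -- (iii) the same integrals through the constant term, transported from `(ν, 𝓕)` to `(ν', 𝓕₀)`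
  have hCT : ∀ z ∈ D, borelConstantTerm ν' 𝓕₀ (Ec z) x = φ₀ * ((((borelHeight x : ℝ≥0) : ℝ) : ℂ) ^ z + cc z * (((borelHeight x : ℝ≥0) : ℝ) : ℂ) ^ (2 - z)) := fun z hz => by
    have hsmul : ν' = ((haarScalarFactor ν' ν : ℝ≥0) : ℝ≥0∞) • ν := by
      rw [← ENNReal.smul_def]; exact isMulLeftInvariant_eq_smul ν' ν
    have hpos : ((haarScalarFactor ν' ν : ℝ≥0) : ℝ≥0∞) ≠ 0 := by exact_mod_cast (haarScalarFactor_pos_of_isHaarMeasure ν' ν).ne'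
    rw [hsmul, borelConstantTerm_smul_measure_eq ν 𝓕₀ hpos ENNReal.coe_ne_top, borelConstantTerm_eq_of_isFundamentalDomain ν h𝓕₀ν h𝓕N (hEcinv z hz), hE3 z hz]
  have heq : (fun z : ℂ => ∫ u in 𝓕₀, (z - 2) * Ec z ((u : (quasiSplit F E c 3).Adelic) * x) ∂ν') =ᶠ[𝓝[≠] 2] fun z =>
      (z - 2) * (((ν' 𝓕₀).toReal : ℂ) * (φ₀ * ((((borelHeight x : ℝ≥0) : ℝ) : ℂ) ^ z + cc z * (((borelHeight x : ℝ≥0) : ℝ) : ℂ) ^ (2 - z)))) := by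
    filter_upwards [hD2] with z hz
    rw [integral_const_mul, ← hCT z hz, borelConstantTerm_def, Complex.real_smul, ← mul_assoc ((ν' 𝓕₀).toReal : ℂ), ← Complex.ofReal_mul, mul_inv_cancel₀ hreal0,
      Complex.ofReal_one, one_mul]
  have hH0 : (((borelHeight x : ℝ≥0) : ℝ) : ℂ) ≠ 0 := by exact_mod_cast (borelHeight_pos x).ne'
  have hlim₂ : Tendsto (fun z : ℂ => (z - 2) * (((ν' 𝓕₀).toReal : ℂ) * (φ₀ * ((((borelHeight x : ℝ≥0) : ℝ) : ℂ) ^ z + cc z * (((borelHeight x : ℝ≥0) : ℝ) : ℂ) ^ (2 - z)))))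
      (𝓝[≠] 2) (𝓝 (((ν' 𝓕₀).toReal : ℂ) * (φ₀ * r))) := by
    have hre : ∀ z : ℂ, (z - 2) * (((ν' 𝓕₀).toReal : ℂ) * (φ₀ * ((((borelHeight x : ℝ≥0) : ℝ) : ℂ) ^ z + cc z * (((borelHeight x : ℝ≥0) : ℝ) : ℂ) ^ (2 - z)))) =
        ((ν' 𝓕₀).toReal : ℂ) * (φ₀ * ((z - 2) * (((borelHeight x : ℝ≥0) : ℝ) : ℂ) ^ z + ((z - 2) * cc z) * (((borelHeight x : ℝ≥0) : ℝ) : ℂ) ^ (2 - z))) := fun z => by ring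
    simp_rw [hre]
    refine Tendsto.const_mul _ (Tendsto.const_mul _ ?_)
    have h1 : Tendsto (fun z : ℂ => (z - 2) * (((borelHeight x : ℝ≥0) : ℝ) : ℂ) ^ z) (𝓝[≠] 2) (𝓝 (0 * (((borelHeight x : ℝ≥0) : ℝ) : ℂ) ^ (2 : ℂ))) := by
      refine tendsto_nhdsWithin_of_tendsto_nhds (Tendsto.mul ?_ (continuousAt_const_cpow hH0).tendsto)
      have : Tendsto (fun z : ℂ => z - 2) (𝓝 2) (𝓝 (2 - 2)) := tendsto_id.sub tendsto_const_nhds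
      rwa [sub_self] at this
    have h2 : Tendsto (fun z : ℂ => ((z - 2) * cc z) * (((borelHeight x : ℝ≥0) : ℝ) : ℂ) ^ (2 - z)) (𝓝[≠] 2) (𝓝 (r * (((borelHeight x : ℝ≥0) : ℝ) : ℂ) ^ ((2 : ℂ) - 2))) :=
      hcres.mul (tendsto_nhdsWithin_of_tendsto_nhds ((continuousAt_const_cpow hH0).comp_of_eq (continuousAt_const.sub continuousAt_id) rfl).tendsto)
    have h := h1.add h2
    simp only [zero_mul, zero_add, sub_self, Complex.cpow_zero, mul_one] at h
    exact h
  have hval : ∫ u in 𝓕₀, Fp ((u : (quasiSplit F E c 3).Adelic) * x) 2 ∂ν' = ((ν' 𝓕₀).toReal : ℂ) * (φ₀ * r) :=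
    tendsto_nhds_unique hlim₁ (hlim₂.congr' heq.symm)
  -- (iv) `∫_{𝓕₀} (F(u x) 2 − φ₀ r) dν' = 0`
  have hintF : IntegrableOn (fun u : ↥(adelicUnipotent F E c 3) => Fp ((u : (quasiSplit F E c 3).Adelic) * x) 2) 𝓕₀ ν' :=
    Measure.integrableOn_of_bounded h𝓕₀top.ne (hRc.comp (continuous_subtype_val.mul continuous_const)).aestronglyMeasurable (M := M₁) (by
      filter_upwards [ae_restrict_mem h𝓕₀m] with u hu using hM₁F _ ⟨u, hK₀ hu, rfl⟩)
  have hzero₀ : ∫ u in 𝓕₀, (Fp ((u : (quasiSplit F E c 3).Adelic) * x) 2 - φ₀ * r) ∂ν' = 0 := by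
    rw [integral_sub hintF (integrableOn_const h𝓕₀top.ne), hval, setIntegral_const, Complex.real_smul, measureReal_def, sub_self]
  -- (v) transport to `𝓕'`
  refine ⟨(h𝓕₀'.integrableOn_iff h𝓕' hIinv).1 hint₀, ?_⟩
  rw [h𝓕'.setIntegral_eq h𝓕₀' hIinv]
  exact hzero₀

end ConstantTerm

end Summit.HodgeConjecture.HodgeConjecture.Cruxes.H413.K2E1ContinuedEisensteinResidueConstantTermUThree

end
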